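import Literature.NumberTheory.Weil1964.AdelicDoublingDiagonalLift
import HarnessLib

/-!
# The Siegel–Weil section at the origin is fixed by the rational points of the Siegel parabolic; the doubling form

Topic `NumberTheory/Weil1964`; namespace `Literature.NumberTheory.Weil1964`.  KERNEL file: theorems over existing tree
declarations (no `def`, no `def … : Prop`, no `sorry`).

The Siegel–Weil section attached to `Φ ∈ 𝒮(X_𝔸)` is `f_Φ(g) = (ω(g)Φ)(0)`; its left invariance under the RATIONAL points
of the Siegel parabolic `P_Y` ([Weil1965, n° 39 (30)]: `f_Φ(pg) = f_Φ(g)` — for the modulus-free lift `𝐫₀` of the tree this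
holds at `x = 0` on all of `P_Y(𝔸)`, and at a rational point `r_F = 𝐫₀` by `Θ`-rigidity) is what makes the Eisenstein sum
`E(Φ) = Σ_{P(F)\G(F)} f_Φ(γ)` well defined.

* §1 (generic `T`, `Fin n`): `omega_adelicSiegelLiftCont_apply_zero` — `(ω(𝐫₀ p)Φ)(0) = Φ(0)` for EVERY `p ∈ P_Y(𝔸)`
  (★ `coe_toOp_adelicSiegelLift`: `(ω(𝐫₀ p)Φ)(x) = ψ_F(q_{−½c_p}(a_p⁻¹x)) Φ(a_p⁻¹x)`, no modulus factor);
  `omega_ratThetaLiftCont_apply_zero_of_mem_siegelParabolicPi` — `(ω(r_F γ)Φ)(0) = Φ(0)` for every rational symplectic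
  matrix `γ` with `ratSp γ ∈ P_Y(𝔸)` (★ Θ-rigidity `coe_ratThetaLiftCont_eq`: `r_F γ = 𝐫₀(ratSp γ)`).
* §2 (doubling, `𝕋 = doubledGramFin F T`, Li's `δ = doublingDeltaRat`, `r_F(δ) = doublingDeltaLift`):
  `omega_doublingDeltaLift_omega_ratThetaLiftCont_apply_zero` — `(ω□(r_F δ) ω□(r_F p) Ψ)(0) = (ω□(r_F δ) Ψ)(0)` whenever
  `ratSp (δ p δ⁻¹) ∈ P_𝕐(𝔸)`, i.e. for the rational stabiliser `δ⁻¹ P_𝕐(F) δ` of the diagonal Lagrangian `W^Δ`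
  ([Li1992, p. 181]) — the «honest invariance» `ev0 (r_F^□(p) • Ψ) = ev0 Ψ` of the Siegel–Eisenstein carrier of the E-2
  child line `Cruxes/H413/Lines/F0_E2SiegelWeilWeilRange.lean` (`ev0 Ψ := (ω□(r_F δ)Ψ)(0)`, `stabDiagRat`), conjunct (i) of
  its `stub_SW2_siegelWeil`.

Cell hodgecm-mathlib, FLOOR 0, engine E-2, crux item H413 (`--supports stmt-HodgeConjecture-24833`).  HC_CM is proved only
modulo the printed citations until rung 0 closes.

## References
* [Weil1965] A. Weil, Acta Math. 113 (1965) 1–87, n° 39 (30) (`f_Φ(pg) = f_Φ(g)`, `E(Φ)`).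
* [Weil1964] A. Weil, Acta Math. 111 (1964) 143–211, Chap. I n° 13 p. 160 (`𝐫₀`), Chap. III n° 40–41 pp. 190–193 (`r_k`).
* [Li1992] J.-S. Li, J. reine angew. Math. 428 (1992) 177–217, p. 181 (`δ`), (25) p. 184 (the section).
* [Kudla1996] S. S. Kudla, *Notes on the local theta correspondence* (1996), I.2 (operator formula on `P_Y`).
-/

set_option autoImplicit false

noncomputable section

namespace Literature.NumberTheory.Weil1964

open Literature.RepresentationTheory.HeisenbergGroup
open Literature.NumberTheory.Automorphic
open NumberField
open scoped Matrix

/-! ## §1 The origin value is fixed by `𝐫₀(P_Y(𝔸))`, hence by `r_F` at rational parabolic points -/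

section Generic

variable (F : Type) [Field F] [NumberField F] {n : ℕ}
variable (T : Matrix (Fin n) (Fin n) (AdeleRing (𝓞 F) F)) (hT : IsUnit T.det)

/-- **`(ω(𝐫₀ p)Φ)(0) = Φ(0)` for every `p ∈ P_Y(𝔸)`**: Weil's canonical lift acts by `Φ ↦ ψ_F(q(a_p⁻¹x)) Φ(a_p⁻¹x)`
(no modulus factor in the tree's normalisation), and `a_p⁻¹ 0 = 0`, `ψ_F(q(0)) = 1`.
[cite: Weil1964, Chap. I n° 13 p. 160] [cite: Kudla1996, I.2] -/
theorem omega_adelicSiegelLiftCont_apply_zero (p : siegelParabolicPi T) (Φ : piSchwartzBruhat F (Fin n)) :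
    ((adelicMpCont.omega F (Fin n) T (adelicSiegelLiftCont F T hT p) Φ : piSchwartzBruhat F (Fin n)) :
        (Fin n → AdeleRing (𝓞 F) F) → ℂ) 0 =
      (Φ : (Fin n → AdeleRing (𝓞 F) F) → ℂ) 0 := by
  have h0 : sdChar F ((-⅟(2 : AdeleRing (𝓞 F) F)) • SiegelParabolicPi.cMat (T := T)
      (p : symplecticGroup (polar (adelicForm F (Fin n) T)))) 0 = 1 := by
    rw [sdChar_apply, Matrix.zero_vecMul, zero_dotProduct, AddChar.map_zero_eq_one, Circle.coe_one]
  have h := coe_toOp_adelicSiegelLift F T hT p Φ 0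
  simp only [Matrix.mulVec_zero, h0, one_mul] at h
  have hc : ((adelicMpCont.omega F (Fin n) T (adelicSiegelLiftCont F T hT p) Φ : piSchwartzBruhat F (Fin n)) :
        (Fin n → AdeleRing (𝓞 F) F) → ℂ) =
      ((MpPsi.toOp (adelicSchrodinger F (Fin n) T) (adelicSiegelLift F T hT p) Φ : piSchwartzBruhat F (Fin n)) :
        (Fin n → AdeleRing (𝓞 F) F) → ℂ) := rfl
  rw [hc]
  exact h

/-- **`(ω(r_F γ)Φ)(0) = Φ(0)` for every rational symplectic matrix `γ` whose image lies in `P_Y(𝔸)`** — at such a point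
`r_F γ = 𝐫₀(ratSp γ)` (both `Θ`-fixing over `ratSp γ`: ★ `coe_ratThetaLiftCont_eq`,
★ `adelicSiegelLift_mem_adelicMpTheta_of_mem_range`). [cite: Weil1965, n° 39 (30)] [cite: Weil1964, Chap. III n° 41 Thm 6 p. 193] -/
theorem omega_ratThetaLiftCont_apply_zero_of_mem_siegelParabolicPi (γ : Matrix.symplecticGroup (Fin n) F)
    (hγ : ratSp F T hT γ ∈ siegelParabolicPi T) (Φ : piSchwartzBruhat F (Fin n)) :
    ((adelicMpCont.omega F (Fin n) T (ratThetaLiftCont F T hT γ) Φ : piSchwartzBruhat F (Fin n)) :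
        (Fin n → AdeleRing (𝓞 F) F) → ℂ) 0 =
      (Φ : (Fin n → AdeleRing (𝓞 F) F) → ℂ) 0 := by
  have hΘ := adelicSiegelLift_mem_adelicMpTheta_of_mem_range F T hT (p := ⟨ratSp F T hT γ, hγ⟩) ⟨γ, rfl⟩
  have heq : ratThetaLiftCont F T hT γ = adelicSiegelLiftCont F T hT ⟨ratSp F T hT γ, hγ⟩ :=
    Subtype.ext (coe_ratThetaLiftCont_eq F T hT hΘ (proj_adelicSiegelLift F T hT _))
  rw [heq]
  exact omega_adelicSiegelLiftCont_apply_zero F T hT _ Φ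

end Generic

/-! ## §2 The doubling form: `ev₀(r_F^□(p) • Ψ) = ev₀(Ψ)` for `p ∈ δ⁻¹ P_𝕐(F) δ`, `ev₀(Ψ) := (ω□(r_F δ)Ψ)(0)` -/

section Doubling

variable (F : Type) [Field F] [NumberField F] {n : ℕ}
variable (T : Matrix (Fin n) (Fin n) (AdeleRing (𝓞 F) F)) (hT : IsUnit T.det)

/-- **THE SIEGEL–WEIL SECTION OF THE DIAGONAL PARABOLIC IS FIXED BY ITS RATIONAL POINTS** (doubling form, frame `X ⊕ X`
with Li's `δ` inside the functional): for a rational doubled symplectic matrix `p` with `ratSp (δ p δ⁻¹) ∈ P_𝕐(𝔸)`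
(`δ = doublingDeltaRat`, so `p` stabilises `δ⁻¹𝕐 = W^Δ`), `(ω□(r_F δ) ω□(r_F p) Ψ)(0) = (ω□(r_F δ) Ψ)(0)` — since
`r_F(δ) r_F(p) = r_F(δpδ⁻¹) r_F(δ)` and §1 applies to `δpδ⁻¹`.  This is conjunct (i) («`ev0_act_P`») of the E-2 child line's
`stub_SW2_siegelWeil` for `P := stabDiagRat`, `ev0 Ψ := (ω□(doublingDeltaLift)Ψ)(0)`.
[cite: Weil1965, n° 39 (30)] [cite: Li1992, p. 181 and (25) p. 184] -/
theorem omega_doublingDeltaLift_omega_ratThetaLiftCont_apply_zero (p : Matrix.symplecticGroup (Fin (n + n)) F)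
    (hp : ratSp F (doubledGramFin F T) (isUnit_det_doubledGramFin F T hT)
        (doublingDeltaRat F * p * (doublingDeltaRat F)⁻¹) ∈ siegelParabolicPi (doubledGramFin F T))
    (Ψ : piSchwartzBruhat F (Fin (n + n))) :
    ((adelicMpCont.omega F (Fin (n + n)) (doubledGramFin F T) (doublingDeltaLift F T hT)
          (adelicMpCont.omega F (Fin (n + n)) (doubledGramFin F T)
            (ratThetaLiftCont F (doubledGramFin F T) (isUnit_det_doubledGramFin F T hT) p) Ψ) :
          piSchwartzBruhat F (Fin (n + n))) : (Fin (n + n) → AdeleRing (𝓞 F) F) → ℂ) 0 =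
      ((adelicMpCont.omega F (Fin (n + n)) (doubledGramFin F T) (doublingDeltaLift F T hT) Ψ :
          piSchwartzBruhat F (Fin (n + n))) : (Fin (n + n) → AdeleRing (𝓞 F) F) → ℂ) 0 := by
  unfold doublingDeltaLift
  -- in the metaplectic group: `r_F(δ) r_F(p) = r_F(δpδ⁻¹) r_F(δ)`
  have e1 : ratThetaLiftCont F (doubledGramFin F T) (isUnit_det_doubledGramFin F T hT) (doublingDeltaRat F) *
        ratThetaLiftCont F (doubledGramFin F T) (isUnit_det_doubledGramFin F T hT) p =
      ratThetaLiftCont F (doubledGramFin F T) (isUnit_det_doubledGramFin F T hT)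
          (doublingDeltaRat F * p * (doublingDeltaRat F)⁻¹) *
        ratThetaLiftCont F (doubledGramFin F T) (isUnit_det_doubledGramFin F T hT) (doublingDeltaRat F) := by
    simp only [map_mul, map_inv, inv_mul_cancel_right]
  -- on vectors
  have e2 : ∀ Ψ' : piSchwartzBruhat F (Fin (n + n)),
      adelicMpCont.omega F (Fin (n + n)) (doubledGramFin F T)
          (ratThetaLiftCont F (doubledGramFin F T) (isUnit_det_doubledGramFin F T hT) (doublingDeltaRat F))
          (adelicMpCont.omega F (Fin (n + n)) (doubledGramFin F T)
            (ratThetaLiftCont F (doubledGramFin F T) (isUnit_det_doubledGramFin F T hT) p) Ψ') =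
        adelicMpCont.omega F (Fin (n + n)) (doubledGramFin F T)
          (ratThetaLiftCont F (doubledGramFin F T) (isUnit_det_doubledGramFin F T hT)
            (doublingDeltaRat F * p * (doublingDeltaRat F)⁻¹))
          (adelicMpCont.omega F (Fin (n + n)) (doubledGramFin F T)
            (ratThetaLiftCont F (doubledGramFin F T) (isUnit_det_doubledGramFin F T hT) (doublingDeltaRat F)) Ψ') :=
    fun Ψ' =>
    -- `.trans` chain through `ω(ab) = ω(a)ω(b)` (no `rw`: the doubled carriers make near-miss unification expensive)
    ((LinearMap.congr_fun (map_mul (adelicMpCont.omega F (Fin (n + n)) (doubledGramFin F T)) _ _) Ψ').symm.trans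
      ((congrArg (fun m => adelicMpCont.omega F (Fin (n + n)) (doubledGramFin F T) m Ψ') e1).trans
        (LinearMap.congr_fun (map_mul (adelicMpCont.omega F (Fin (n + n)) (doubledGramFin F T)) _ _) Ψ')))
  exact (congrArg (fun Φ' : piSchwartzBruhat F (Fin (n + n)) => (Φ' : (Fin (n + n) → AdeleRing (𝓞 F) F) → ℂ) 0)
      (e2 Ψ)).trans
    (omega_ratThetaLiftCont_apply_zero_of_mem_siegelParabolicPi F (doubledGramFin F T)
      (isUnit_det_doubledGramFin F T hT) _ hp _)

end Doubling

end Literature.NumberTheory.Weil1964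

end
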